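import Summits.BirchSwinnertonDyer.Rank1Residual.ManinAdditive.ModularFunctionFieldLevel
import HarnessLib

/-!
# Newman `η`-quotients of weight `0` have `q`-series in the modular function field `K_M` (M1) — an g36, T-an-39 (b) file L, part 2/2

TYPER NOTE (typer g19).  SOURCE = HOME/an/g36/ModularFunctionFieldEtaProofs-an-g36.lean sha16 a1577e89bb8f6fea, Part III (an's lines 318–626) VERBATIM
except this note, `[folklore]` docstrings on undocumented helpers, and the namespace/home (see part 1 `ModularFunctionFieldLevel.lean`: the
Literature placement was refused by `lint.literature-cited-only`; namespace `Summit.BirchSwinnertonDyer.Rank1Residual.ManinAdditive.ModularFunctionFieldEta`).  CONTENT (an): the objects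
`toLaurent`, `etaPos`, `etaNeg`, `etaLaurent` (bodies IDENTICAL to the cell's statement file `CuspidalKummerCubeDescent.lean` = FILE A, so the cell
Props M0/M1/M2 close by `exact` in FILE F), `eulerUnit` and its `q`-expansion, the padding arithmetic `padN/expF/expG/wt` (Newman's conditions in
weight `12nσ₀(M)`), and **M1 `etaLaurent_mem_modularFunctionField : NewmanCond M s 0 → etaLaurent M s ∈ modularFunctionField M`** with its shape
`etaQuotientMemFunctionField_shape`; input = the tree's `etaQuotientCuspForm` (Savitt 2025 Thm. 1 as typed in `ModularCurveEtaQuotientsProofs`).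
Nothing conjectured; no instance / notation.  PARTITION 0 · beyond-print theorem: no · BSD is not proved by this; C2/C3 OPEN.
-/

noncomputable section

open UpperHalfPlane hiding I
open ModularForm SlashInvariantForm ModularFormClass Complex CongruenceSubgroup Filter Function PowerSeries
open scoped MatrixGroups Real Topology
open Literature.NumberTheory.EllipticCurves.ModularForms

namespace Summit.BirchSwinnertonDyer.Rank1Residual.ManinAdditive.ModularFunctionFieldEta


/-! ## Part III — M1: Newman `η`-quotients of weight `0` have `q`-series in `K_M` -/

/-! ### The objects (bodies identical to the cell's FILE A `CuspidalKummerThree.toLaurent/etaPos/etaNeg/etaLaurent`) -/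

/-- An integer power series as a complex Laurent series. [folklore] -/
def toLaurent (p : ℤ⟦X⟧) : LaurentSeries ℂ := HahnSeries.ofPowerSeries ℤ ℂ (p.map (Int.castRingHom ℂ))

/-- `∏_{δ ∣ M} E(q^δ)^{max(s_δ,0)}`. [folklore] -/
def etaPos (M : ℕ) (s : ℕ → ℤ) : ℤ⟦X⟧ := ∏ δ ∈ M.divisors, formalEulerScaled δ ^ (s δ).toNat

/-- `∏_{δ ∣ M} E(q^δ)^{max(−s_δ,0)}`. [folklore] -/
def etaNeg (M : ℕ) (s : ℕ → ℤ) : ℤ⟦X⟧ := ∏ δ ∈ M.divisors, formalEulerScaled δ ^ (-(s δ)).toNat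

/-- `q^{S₁(s)/24}·etaPos/etaNeg`, the `q`-series of `∏ η(δτ)^{s_δ}`. [folklore] -/
def etaLaurent (M : ℕ) (s : ℕ → ℤ) : LaurentSeries ℂ :=
  HahnSeries.single ((∑ δ ∈ M.divisors, (δ : ℤ) * s δ) / 24) (1 : ℂ) *
    (toLaurent (etaPos M s) / toLaurent (etaNeg M s))

/-- `toLaurent` is multiplicative. [folklore] -/
theorem toLaurent_mul (p q : ℤ⟦X⟧) : toLaurent (p * q) = toLaurent p * toLaurent q := by
  simp [toLaurent]

/-- A power series with constant coefficient `1` has non-zero Laurent image. [folklore] -/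
theorem toLaurent_ne_zero_of_constantCoeff {p : ℤ⟦X⟧} (hp : constantCoeff p = 1) : toLaurent p ≠ 0 := by
  intro h
  have := congrArg (fun x ↦ x.coeff ((0 : ℕ) : ℤ)) h
  simp only [toLaurent, HahnSeries.ofPowerSeries_apply_coeff, coeff_map,
    coeff_zero_eq_constantCoeff_apply, hp, map_one, HahnSeries.coeff_zero] at this
  exact one_ne_zero this

/-- `etaNeg` has constant coefficient `1`. [folklore] -/
theorem constantCoeff_etaNeg (M : ℕ) (s : ℕ → ℤ) : constantCoeff (etaNeg M s) = 1 := by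
  simp [etaNeg, map_prod, map_pow, constantCoeff_formalEulerScaled]

/-- Laurent image of `X^e · P` as `single e 1 · toLaurent P`. [folklore] -/
theorem ofPowerSeries_X_pow_mul_map (e : ℕ) (P : ℤ⟦X⟧) :
    HahnSeries.ofPowerSeries ℤ ℂ (X ^ e * P.map (Int.castRingHom ℂ)) =
      HahnSeries.single (e : ℤ) 1 * toLaurent P := by
  rw [map_mul, HahnSeries.ofPowerSeries_X_pow]
  rfl

/-! ### `q`-expansions of unit products `∏ E(q^δ)^{r_δ}` -/

/-- The unit part `∏_{δ ∣ M} E(q^δ)^{r_δ}` (`r_δ ≥ 0` truncated) as a function on `ℍ`. [folklore] -/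
def eulerUnit (M : ℕ) (r : ℕ → ℤ) : ℍ → ℂ := ∏ δ ∈ M.divisors, eulerFn δ ^ (r δ).toNat


/-- Pointwise formula for `eulerUnit`. [folklore] -/
theorem eulerUnit_apply (M : ℕ) (r : ℕ → ℤ) (τ : ℍ) :
    eulerUnit M r τ = ∏ δ ∈ M.divisors, eulerFn δ τ ^ (r δ).toNat := by
  simp [eulerUnit, Finset.prod_apply]

/-- `eulerUnit M r` has an integral unit `q`-expansion. [folklore] -/
theorem isIntUnitQExp_eulerUnit (M : ℕ) (r : ℕ → ℤ) : IsIntUnitQExp (eulerUnit M r) :=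
  IsIntUnitQExp.prod _ fun _ hδ ↦ (isIntUnitQExp_eulerFn (Nat.pos_of_mem_divisors hδ)).pow _

/-- `q`-expansion of a power of an integral-unit function. [folklore] -/
theorem qExpansion_pow_of_isIntUnitQExp {f : ℍ → ℂ} (hf : IsIntUnitQExp f) (n : ℕ) :
    qExpansion 1 (f ^ n) = qExpansion 1 f ^ n := by
  induction n with
  | zero => rw [pow_zero, pow_zero]; exact qExpansion_one 1
  | succ n ih => rw [pow_succ, pow_succ, qExpansion_mul (hf.pow n).analyticAt hf.analyticAt, ih]

/-- `q`-expansion of a finite product of integral-unit functions. [folklore] -/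
theorem qExpansion_prod_of_isIntUnitQExp {ι : Type*} (s : Finset ι) (F : ι → ℍ → ℂ)
    (h : ∀ i ∈ s, IsIntUnitQExp (F i)) :
    qExpansion 1 (∏ i ∈ s, F i) = ∏ i ∈ s, qExpansion 1 (F i) := by
  classical
  induction s using Finset.induction_on with
  | empty => rw [Finset.prod_empty, Finset.prod_empty]; exact qExpansion_one 1
  | insert a s ha ih =>
    rw [Finset.prod_insert ha, Finset.prod_insert ha,
      qExpansion_mul (h a (Finset.mem_insert_self a s)).analyticAt
        (IsIntUnitQExp.prod s fun i hi ↦ h i (Finset.mem_insert_of_mem hi)).analyticAt,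
      ih fun i hi ↦ h i (Finset.mem_insert_of_mem hi)]

/-- The formal `q`-expansion of `eulerUnit M r` is `∏ E(X^δ)^{r_δ}`. [folklore] -/
theorem qExpansion_eulerUnit (M : ℕ) (r : ℕ → ℤ) :
    qExpansion 1 (eulerUnit M r) = (etaPos M r).map (Int.castRingHom ℂ) := by
  rw [eulerUnit, qExpansion_prod_of_isIntUnitQExp _ _
    (fun δ hδ ↦ (isIntUnitQExp_eulerFn (Nat.pos_of_mem_divisors hδ)).pow _), etaPos, map_prod]
  refine Finset.prod_congr rfl fun δ hδ ↦ ?_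
  rw [qExpansion_pow_of_isIntUnitQExp (isIntUnitQExp_eulerFn (Nat.pos_of_mem_divisors hδ)),
    qExpansion_eulerFn (Nat.pos_of_mem_divisors hδ), map_pow]

/-- `∏ η(δτ)^{r_δ} = q^e · ∏ E(q^δ)^{r_δ}` when `r ≥ 0` and `Σ δ r_δ = 24e`. [folklore] -/
theorem etaQuotient_eq_qParam_pow_mul_eulerUnit (M : ℕ) (r : ℕ → ℤ) (e : ℕ)
    (hS : ∑ δ ∈ M.divisors, (δ : ℤ) * r δ = 24 * e) (hr : ∀ δ ∈ M.divisors, 0 ≤ r δ) (τ : ℍ) :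
    etaQuotient M r τ = Periodic.qParam 1 (τ : ℂ) ^ e * eulerUnit M r τ := by
  rw [etaQuotient_apply, eulerUnit_apply]
  simp_rw [eta_natMul_eq_qParam_mul_eulerFn, mul_zpow, Finset.prod_mul_distrib]
  have hq : ∀ δ : ℕ, Periodic.qParam 24 ((δ : ℂ) * τ) ^ (r δ) =
      cexp (2 * π * I * τ / 24 * (((δ : ℤ) * r δ : ℤ) : ℂ)) := fun δ ↦ by
    rw [Periodic.qParam, ← Complex.exp_int_mul]
    congr 1
    push_cast
    ring
  simp_rw [hq]
  rw [← Complex.exp_sum, ← Finset.mul_sum, ← Int.cast_sum, hS]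
  congr 1
  · rw [Periodic.qParam, ← Complex.exp_nat_mul]
    congr 1
    push_cast
    ring
  · exact Finset.prod_congr rfl fun δ hδ ↦ by rw [← zpow_natCast, Int.toNat_of_nonneg (hr δ hδ)]

/-- If a `Γ₀(M)`-form equals `q^e · U` with `U` an integral unit `q`-series, its `q`-expansion is
`X^e · qExpansion U`. [folklore] -/
theorem qExpansion_eq_X_pow_mul {M : ℕ} {k : ℤ} (F : ModularForm (Gamma0 M) k) {U : ℍ → ℂ}
    (hU : IsIntUnitQExp U) (e : ℕ) (hF : ∀ τ : ℍ, F τ = Periodic.qParam 1 (τ : ℂ) ^ e * U τ) :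
    qExpansion 1 F = X ^ e * qExpansion 1 U := by
  haveI : Fact (IsCusp OnePoint.infty (Gamma0 M : Subgroup (GL (Fin 2) ℝ))) :=
    ⟨(Gamma0 M : Subgroup (GL (Fin 2) ℝ)).isCusp_of_mem_strictPeriods one_pos
      (one_mem_strictPeriods_coe_gamma0 M)⟩
  have hper := SlashInvariantFormClass.periodic_comp_ofComplex F (one_mem_strictPeriods_coe_gamma0 M)
  ext m
  rw [coeff_X_pow_mul']
  refine qExpansion_one_coeff_eq_of_hasSum
    (c := fun m : ℕ ↦ ite (e ≤ m) ((qExpansion 1 U).coeff (m - e)) 0) hper (ModularFormClass.holo F)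
    (ModularFormClass.bdd_at_infty F) (fun τ ↦ ?_) m
  set q := Periodic.qParam 1 (τ : ℂ) with hq
  have hUsum := hasSum_qExpansion one_pos hU.periodic hU.mdiff hU.bdd τ
  have h1 : HasSum (fun m : ℕ ↦ (ite (e ≤ m + e) ((qExpansion 1 U).coeff (m + e - e)) 0) • q ^ (m + e))
      (q ^ e * U τ) := by
    have := hUsum.mul_left (q ^ e)
    have hfun : (fun i : ℕ ↦ q ^ e * ((qExpansion 1 U).coeff i • Periodic.qParam 1 (τ : ℂ) ^ i)) =
        fun m : ℕ ↦ (ite (e ≤ m + e) ((qExpansion 1 U).coeff (m + e - e)) 0) • q ^ (m + e) := by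
      funext m
      rw [if_pos (Nat.le_add_left e m), Nat.add_sub_cancel, smul_eq_mul, smul_eq_mul, pow_add, ← hq]
      ring
    rw [hfun] at this
    exact this
  have h2 := (hasSum_nat_add_iff
    (f := fun m : ℕ ↦ (ite (e ≤ m) ((qExpansion 1 U).coeff (m - e)) 0) • q ^ m) e).mp h1
  have h3 : ∑ i ∈ Finset.range e, (ite (e ≤ i) ((qExpansion 1 U).coeff (i - e)) 0) • q ^ i = 0 :=
    Finset.sum_eq_zero fun i hi ↦ by
      rw [if_neg (not_le.mpr (Finset.mem_range.mp hi)), zero_smul]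
  rw [h3, add_zero, ← hF τ] at h2
  exact h2

/-! ### Exponent arithmetic: padding `s` by `24n` -/

section Pad

variable (M : ℕ) (s : ℕ → ℤ)

/-- `n = 1 + Σ_{δ ∣ M} |s_δ|`. [folklore] -/
def padN : ℕ := ∑ δ ∈ M.divisors, (s δ).natAbs + 1

/-- `g_δ = 24 n`. [folklore] -/
def expG : ℕ → ℤ := fun _ ↦ 24 * (padN M s : ℤ)

/-- `f_δ = s_δ + 24 n`. [folklore] -/
def expF : ℕ → ℤ := fun δ ↦ s δ + 24 * (padN M s : ℤ)

/-- the common weight `12 n σ₀(M)`. [folklore] -/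
def wt : ℤ := 12 * (padN M s : ℤ) * (M.divisors.card : ℤ)

/-- Each exponent is smaller in absolute value than the padding `padN`. [folklore] -/
theorem natAbs_lt_padN {δ : ℕ} (hδ : δ ∈ M.divisors) : (s δ).natAbs < padN M s := by
  unfold padN
  have := Finset.single_le_sum (f := fun δ ↦ (s δ).natAbs) (fun _ _ ↦ Nat.zero_le _) hδ
  omega

/-- The padded numerator exponents `expF` are positive. [folklore] -/
theorem expF_pos {δ : ℕ} (hδ : δ ∈ M.divisors) : 0 < expF M s δ := by
  have := natAbs_lt_padN M s hδ
  unfold expF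
  omega

/-- The denominator exponents `expG` are positive. [folklore] -/
theorem expG_pos (δ : ℕ) : 0 < expG M s δ := by
  unfold expG padN
  push_cast
  positivity

/-- The padding weight `wt` is even. [folklore] -/
theorem even_wt : Even (wt M s) := ⟨6 * (padN M s : ℤ) * (M.divisors.card : ℤ), by unfold wt; ring⟩

/-- The denominator exponent vector satisfies Newman's conditions in weight `wt`. [folklore] -/
theorem newmanCond_expG : NewmanCond M (expG M s) (wt M s) where
  sum_eq := by simp only [expG, Finset.sum_const, wt]; ring
  sum_mul_dvd := Finset.dvd_sum fun δ _ ↦ ⟨(δ : ℤ) * padN M s, by unfold expG; ring⟩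
  sum_div_dvd := Finset.dvd_sum fun δ _ ↦ ⟨((M / δ : ℕ) : ℤ) * padN M s, by unfold expG; ring⟩
  isSquare := ⟨∏ δ ∈ M.divisors, δ ^ (12 * padN M s), by
    rw [← Finset.prod_mul_distrib]
    refine Finset.prod_congr rfl fun δ _ ↦ ?_
    rw [← pow_add]
    congr 1
    unfold expG
    omega⟩

/-- `X · A² = Y²` with `A ≠ 0` forces `X` to be a square. [folklore] -/
theorem isSquare_of_mul_sq_eq_sq {X A Y : ℕ} (hA : A ≠ 0) (h : X * A ^ 2 = Y ^ 2) : IsSquare X := by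
  have hdvd : A ^ 2 ∣ Y ^ 2 := ⟨X, by rw [← h, mul_comm]⟩
  obtain ⟨Z, rfl⟩ := (Nat.pow_dvd_pow_iff two_ne_zero).mp hdvd
  refine ⟨Z, ?_⟩
  have hA2 : 0 < A ^ 2 := by positivity
  have : X * A ^ 2 = (Z * Z) * A ^ 2 := by rw [h]; ring
  exact Nat.eq_of_mul_eq_mul_right hA2 this

/-- The padded numerator exponent vector satisfies Newman's conditions in weight `wt`. [folklore] -/
theorem newmanCond_expF (hs : NewmanCond M s 0) : NewmanCond M (expF M s) (wt M s) where
  sum_eq := by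
    have h := hs.sum_eq
    simp only [mul_zero] at h
    simp only [expF, Finset.sum_add_distrib, h, zero_add, Finset.sum_const, wt]
    ring
  sum_mul_dvd := by
    simp only [expF, mul_add, Finset.sum_add_distrib]
    exact dvd_add hs.sum_mul_dvd (Finset.dvd_sum fun δ _ ↦ ⟨(δ : ℤ) * padN M s, by ring⟩)
  sum_div_dvd := by
    simp only [expF, mul_add, Finset.sum_add_distrib]
    exact dvd_add hs.sum_div_dvd (Finset.dvd_sum fun δ _ ↦ ⟨((M / δ : ℕ) : ℤ) * padN M s, by ring⟩)
  isSquare := by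
    obtain ⟨B, hB⟩ := hs.isSquare
    have hA : (∏ δ ∈ M.divisors, δ ^ (-(s δ)).toNat) ≠ 0 :=
      Finset.prod_ne_zero_iff.mpr fun δ hδ ↦ pow_ne_zero _ (Nat.pos_of_mem_divisors hδ).ne'
    refine isSquare_of_mul_sq_eq_sq hA (Y := B * ∏ δ ∈ M.divisors, δ ^ (12 * padN M s)) ?_
    have lhs : (∏ δ ∈ M.divisors, δ ^ (expF M s δ).natAbs) * (∏ δ ∈ M.divisors, δ ^ (-(s δ)).toNat) ^ 2 =
        ∏ δ ∈ M.divisors, δ ^ ((s δ).natAbs + 24 * padN M s) := by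
      rw [← Finset.prod_pow, ← Finset.prod_mul_distrib]
      refine Finset.prod_congr rfl fun δ hδ ↦ ?_
      rw [← pow_mul, ← pow_add]
      congr 1
      have := natAbs_lt_padN M s hδ
      unfold expF
      omega
    have rhs : (B * ∏ δ ∈ M.divisors, δ ^ (12 * padN M s)) ^ 2 =
        ∏ δ ∈ M.divisors, δ ^ ((s δ).natAbs + 24 * padN M s) := by
      rw [mul_pow, sq B, ← hB, ← Finset.prod_pow, ← Finset.prod_mul_distrib]
      refine Finset.prod_congr rfl fun δ _ ↦ ?_
      rw [← pow_mul, ← pow_add]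
      congr 1
      omega
    rw [lhs, rhs]

end Pad

/-- Ligozat orders are positive at every cusp when all exponents are positive. [folklore] -/
theorem cuspOrder24_pos_of_pos {M : ℕ} (hM : M ≠ 0) {r : ℕ → ℤ} (hr : ∀ δ ∈ M.divisors, 0 < r δ)
    (t : ℕ) : 0 < cuspOrder24 M r t := by
  unfold cuspOrder24
  have hMmem : M ∈ M.divisors := Nat.mem_divisors_self M hM
  have hterm : ∀ δ ∈ M.divisors, 0 ≤ r δ * (Int.gcd δ t : ℤ) ^ 2 * ((M / δ : ℕ) : ℤ) := fun δ hδ ↦ by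
    have := hr δ hδ
    positivity
  refine lt_of_lt_of_le ?_ (Finset.single_le_sum hterm hMmem)
  have h1 : 0 < r M := hr M hMmem
  have hM' : (M : ℤ) ≠ 0 := by exact_mod_cast hM
  have h2 : 0 < (Int.gcd (M : ℤ) (t : ℤ) : ℤ) := by
    have h := Int.gcd_pos_of_ne_zero_left (t : ℤ) hM'
    exact_mod_cast h
  have h3 : ((M / M : ℕ) : ℤ) = 1 := by rw [Nat.div_self (Nat.pos_of_ne_zero hM)]; simp
  rw [h3]
  positivity

/-- **M1 (PROVED): for `s` satisfying Newman's conditions in weight `0`, the `q`-series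
`q^{S₁(s)/24} ∏ E(q^δ)^{s_δ}` lies in the modular function field `K_M`.** [folklore] -/
theorem etaLaurent_mem_modularFunctionField (M : ℕ) [NeZero M] (s : ℕ → ℤ) (hs : NewmanCond M s 0) :
    etaLaurent M s ∈ modularFunctionField M := by
  have hM : M ≠ 0 := NeZero.ne M
  have hMmem : M ∈ M.divisors := Nat.mem_divisors_self M hM
  have hk := even_wt M s
  have hcF := newmanCond_expF M s hs
  have hcG := newmanCond_expG M s
  have hordF : ∀ t ∈ M.divisors, 0 < cuspOrder24 M (expF M s) t := fun t _ ↦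
    cuspOrder24_pos_of_pos hM (fun δ hδ ↦ expF_pos M s hδ) t
  have hordG : ∀ t ∈ M.divisors, 0 < cuspOrder24 M (expG M s) t := fun t _ ↦
    cuspOrder24_pos_of_pos hM (fun δ _ ↦ expG_pos M s δ) t
  let F : ModularForm (Gamma0 M) (wt M s) :=
    ((etaQuotientCuspForm M (expF M s) (wt M s) hk hcF hordF : CuspForm (Gamma0 M) (wt M s)) :
      ModularForm (Gamma0 M) (wt M s))
  let G : ModularForm (Gamma0 M) (wt M s) :=
    ((etaQuotientCuspForm M (expG M s) (wt M s) hk hcG hordG : CuspForm (Gamma0 M) (wt M s)) :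
      ModularForm (Gamma0 M) (wt M s))
  have hFcoe : ∀ τ : ℍ, F τ = etaQuotient M (expF M s) τ := fun τ ↦ rfl
  have hGcoe : ∀ τ : ℍ, G τ = etaQuotient M (expG M s) τ := fun τ ↦ rfl
  -- orders at `∞`
  obtain ⟨a, ha⟩ := hs.sum_mul_dvd
  set eG : ℕ := padN M s * ∑ δ ∈ M.divisors, δ with heG
  have hSG : ∑ δ ∈ M.divisors, (δ : ℤ) * expG M s δ = 24 * (eG : ℕ) := by
    simp only [expG, heG, ← Finset.sum_mul]
    push_cast
    ring
  have hSF' : ∑ δ ∈ M.divisors, (δ : ℤ) * expF M s δ = 24 * (a + eG) := by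
    simp only [expF, mul_add, Finset.sum_add_distrib, ha]
    have : ∑ δ ∈ M.divisors, (δ : ℤ) * (24 * (padN M s : ℤ)) = 24 * (eG : ℤ) := by
      simp only [heG, ← Finset.sum_mul]
      push_cast
      ring
    rw [this]
  have hpos : 0 < ∑ δ ∈ M.divisors, (δ : ℤ) * expF M s δ :=
    Finset.sum_pos (fun δ hδ ↦ mul_pos (by exact_mod_cast Nat.pos_of_mem_divisors hδ) (expF_pos M s hδ))
      ⟨M, hMmem⟩
  have haeG : 0 ≤ a + eG := by rw [hSF'] at hpos; omega
  set eF : ℕ := (a + eG).toNat with heF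
  have heF' : (eF : ℤ) = a + eG := Int.toNat_of_nonneg haeG
  have hSF : ∑ δ ∈ M.divisors, (δ : ℤ) * expF M s δ = 24 * (eF : ℕ) := by rw [hSF', heF']
  -- `q`-expansions
  have hFfun : ∀ τ : ℍ, F τ = Periodic.qParam 1 (τ : ℂ) ^ eF * eulerUnit M (expF M s) τ := fun τ ↦ by
    rw [hFcoe]
    exact etaQuotient_eq_qParam_pow_mul_eulerUnit M _ eF hSF (fun δ hδ ↦ (expF_pos M s hδ).le) τ
  have hGfun : ∀ τ : ℍ, G τ = Periodic.qParam 1 (τ : ℂ) ^ eG * eulerUnit M (expG M s) τ := fun τ ↦ by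
    rw [hGcoe]
    exact etaQuotient_eq_qParam_pow_mul_eulerUnit M _ eG hSG (fun δ _ ↦ (expG_pos M s δ).le) τ
  have hqF : qExpansion 1 F = X ^ eF * (etaPos M (expF M s)).map (Int.castRingHom ℂ) := by
    rw [qExpansion_eq_X_pow_mul F (isIntUnitQExp_eulerUnit M _) eF hFfun, qExpansion_eulerUnit]
  have hqG : qExpansion 1 G = X ^ eG * (etaPos M (expG M s)).map (Int.castRingHom ℂ) := by
    rw [qExpansion_eq_X_pow_mul G (isIntUnitQExp_eulerUnit M _) eG hGfun, qExpansion_eulerUnit]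
  -- the power-series identity `etaPos s · etaPos g = etaPos f · etaNeg s`
  have hPS : etaPos M s * etaPos M (expG M s) = etaPos M (expF M s) * etaNeg M s := by
    simp only [etaPos, etaNeg, ← Finset.prod_mul_distrib, ← pow_add]
    refine Finset.prod_congr rfl fun δ hδ ↦ ?_
    congr 1
    have := natAbs_lt_padN M s hδ
    unfold expF expG
    omega
  have hexp : (∑ δ ∈ M.divisors, (δ : ℤ) * s δ) / 24 + (eG : ℤ) = eF := by
    rw [ha, heF', Int.mul_ediv_cancel_left _ (by norm_num : (24 : ℤ) ≠ 0)]
  have hneg : toLaurent (etaNeg M s) ≠ 0 := toLaurent_ne_zero_of_constantCoeff (constantCoeff_etaNeg M s)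
  -- membership
  refine ⟨wt M s, F, G, ?_, ?_⟩
  · intro h0
    have := DFunLike.congr_fun h0 UpperHalfPlane.I
    rw [hGcoe, ModularForm.zero_apply] at this
    exact etaQuotient_ne_zero M _ _ this
  · rw [qExpansionL_def, qExpansionL_def, hqG, hqF, ofPowerSeries_X_pow_mul_map,
      ofPowerSeries_X_pow_mul_map, etaLaurent, div_eq_mul_inv]
    calc HahnSeries.single ((∑ δ ∈ M.divisors, (δ : ℤ) * s δ) / 24) (1 : ℂ) *
          (toLaurent (etaPos M s) * (toLaurent (etaNeg M s))⁻¹) *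
          (HahnSeries.single (eG : ℤ) 1 * toLaurent (etaPos M (expG M s)))
        = HahnSeries.single ((∑ δ ∈ M.divisors, (δ : ℤ) * s δ) / 24) (1 : ℂ) * HahnSeries.single (eG : ℤ) 1 *
            (toLaurent (etaPos M s) * toLaurent (etaPos M (expG M s))) * (toLaurent (etaNeg M s))⁻¹ := by
          ring
      _ = HahnSeries.single (eF : ℤ) (1 : ℂ) *
            (toLaurent (etaPos M (expF M s)) * toLaurent (etaNeg M s)) * (toLaurent (etaNeg M s))⁻¹ := by
          rw [HahnSeries.single_mul_single, mul_one, hexp, ← toLaurent_mul, hPS, toLaurent_mul]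
      _ = HahnSeries.single (eF : ℤ) (1 : ℂ) * toLaurent (etaPos M (expF M s)) := by
          rw [mul_assoc, mul_inv_cancel_right₀ hneg]

/-- M1 in the exact shape of FILE A's `CuspidalKummerThree.EtaQuotientMemFunctionField`. [folklore] -/
theorem etaQuotientMemFunctionField_shape :
    ∀ (M : ℕ) [NeZero M] (s : ℕ → ℤ), NewmanCond M s 0 → etaLaurent M s ∈ modularFunctionField M :=
  fun M _ s hs ↦ etaLaurent_mem_modularFunctionField M s hs

end Summit.BirchSwinnertonDyer.Rank1Residual.ManinAdditive.ModularFunctionFieldEta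

end
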